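import Summits.CriticalPhenomena.CardyFormulaZ2.Theorems.CardyBoundaryCoulombGasBoundaryDefectGaussianRStubTransportPathsPart11
import Summits.CriticalPhenomena.CardyFormulaZ2.Theorems.CardyBoundaryCoulombGasBoundaryDefectGaussianRStubGreenKernelAsymptoticsPart2

/-!
# Stub `stub_transportPaths` of line `rainbow-monomials-in-excursion-kernels` — Part 12:
# uniform flat charts along the edges of the polygon
# (crux `CardyBoundaryCoulombGas.BoundaryDefectGaussianR`, stmt-CriticalPhenomena-14132)

(G1)/(G2) of the design note, uniformly: let `q = γ t₀` be a point of the edge `z`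
(`t₀ ∈ [c z, c (z+1)]`) at distance `≥ λ` from both corners of the edge, where `λ > 0` is at most
the feature size `κ₀` of Part 11 (`tp_nonadjacent_dist`). Then

* `tp_frontier_near_edge` — the frontier within `λ` of `q` lies on the edge:
  `w = q + s i^(a z)`, `|s| < λ` (other edges are either adjacent — and then at least as far as
  the common corner, `tp_adjacent_dist` — or at distance `≥ κ₀`);
* `tp_edge_chart` — hence (half-disc dichotomy `flat_halfDisc` of the tree + the pointwise
  oriented flat chart at `q`) within `λ` of `q`: `w ∈ closure D ↔ im ((w - q)(-i)^(a z)) ≥ 0` and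
  `w ∈ D ↔ im ((w - q)(-i)^(a z)) > 0`.
This is the flatness radius `ρ/4` (resp. `r`) of TRANSPORT at every position of a mover (resp. a
parked point) at distance `≥ ρ/4` (resp. `r`) from the corners. All [folklore].
-/

noncomputable section

open Set Filter Metric Topology
open Literature.Probability.RandomPlanarGeometry
open Summit.CriticalPhenomena.CardyFormulaZ2.Cruxes.RectilinearCardy.ExcursionKernelCovariance

namespace Summit.CriticalPhenomena.CardyFormulaZ2.Cruxes.BoundaryDefectGaussianR.RainbowMonomialsInExcursionKernels

/-- **The frontier near an interior stretch of an edge lies on the edge.** With the polygon data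
of Part 8 and the feature size `κ₀` of `tp_nonadjacent_dist`: if `q = γ t₀`, `t₀ ∈ [c z, c (z+1)]`,
`0 < λ ≤ κ₀` and `λ ≤ ‖q - γ (c z)‖`, `λ ≤ ‖γ (c (z+1)) - q‖`, then every frontier point within `λ`
of `q` is `q + s i^(a z)` with `|s| < λ`. [folklore] -/
theorem tp_frontier_near_edge (D : JordanDomain) {M : ℕ} {c : ℤ → ℝ} {a τ : ℤ → ℕ}
    (hM2 : 2 ≤ M) (hcmono : StrictMono c) (hcper : ∀ z, c (z + M) = c z + 1)
    (ha4 : ∀ z, a z < 4) (hτ : ∀ z, τ z = 1 ∨ τ z = 3)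
    (hmodτ : ∀ z, (a z + τ z) % 4 = (a (z - 1) + 2) % 4)
    (hdir : ∀ z, ∀ t ∈ Icc (c z) (c (z + 1)), D.boundary t =
      D.boundary (c z) + ((‖D.boundary t - D.boundary (c z)‖ : ℝ) : ℂ) * Complex.I ^ (a z))
    (hmono : ∀ z, StrictMonoOn (fun t => ‖D.boundary t - D.boundary (c z)‖) (Icc (c z) (c (z + 1))))
    {κ₀ : ℝ} (hκ₀ : ∀ z z' : ℤ, z + 2 ≤ z' → z' ≤ z + M - 2 →
      ∀ t ∈ Icc (c z) (c (z + 1)), ∀ t' ∈ Icc (c z') (c (z' + 1)),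
        κ₀ ≤ dist (D.boundary t) (D.boundary t'))
    {z : ℤ} {t₀ : ℝ} (ht₀ : t₀ ∈ Icc (c z) (c (z + 1))) {lam : ℝ}
    (hlamκ : lam ≤ κ₀) (hlam1 : lam ≤ ‖D.boundary t₀ - D.boundary (c z)‖)
    (hlam2 : lam ≤ ‖D.boundary (c (z + 1)) - D.boundary t₀‖) :
    ∀ w ∈ frontier D.carrier, dist w (D.boundary t₀) < lam →
      ∃ s : ℝ, |s| < lam ∧ w = D.boundary t₀ + (s : ℂ) * Complex.I ^ (a z) := by
  set γ := D.boundary with hγ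
  intro w hw hd
  rw [← D.range_boundary] at hw
  obtain ⟨s₀, rfl⟩ := hw
  change dist (γ s₀) (γ t₀) < lam at hd
  change ∃ s : ℝ, |s| < lam ∧ γ s₀ = γ t₀ + (s : ℂ) * Complex.I ^ (a z)
  obtain ⟨z', hz'1, hz'2, n, ht⟩ := tp_param_cover (by omega : 0 < M) hcper s₀ (z - 1)
  have hγt : γ (s₀ + n) = γ s₀ := by
    have := (D.periodic_boundary.int_mul n) s₀; rwa [mul_one] at this
  rw [← hγt] at hd ⊢
  set t := s₀ + n with htdef
  -- the edge `z` seen from its start `P = γ (c z)`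
  set f : ℝ → ℝ := fun t => ‖γ t - γ (c z)‖ with hf
  have hzt₀ : γ t₀ = γ (c z) + ((f t₀ : ℝ) : ℂ) * Complex.I ^ (a z) := hdir z t₀ ht₀
  rcases lt_trichotomy z' z with hlt | heq | hgt
  · -- the previous edge: too far (Pythagoras at the corner `γ (c z)`)
    exfalso
    have hz' : z' = z - 1 := by omega
    subst hz'
    have hprev := hdir (z - 1)
    have hprevm := hmono (z - 1)
    rw [sub_add_cancel] at hprev hprevm
    obtain ⟨-, -, hin, -⟩ :=
      tp_seg_rebase_pow hprev hprevm (s := c z) ⟨(hcmono (by omega : z - 1 < z)).le, le_rfl⟩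
    have htI : t ∈ Icc (c (z - 1)) (c z) := by
      refine ⟨ht.1, ?_⟩; have := ht.2; rw [sub_add_cancel] at this; exact this.le
    have hwt := hin t htI
    -- `γ t = P + ‖γ t - P‖ i^(a(z-1)+2)`, `γ t₀ = P + f t₀ i^(a z)`
    have hodd : (a z + (a (z - 1) + 2)) % 2 = 1 := by
      have := tp_consecutive_odd hτ hmodτ z; omega
    have hmod4 : Complex.I ^ (a (z - 1) + 2) = Complex.I ^ ((a (z - 1) + 2) % 4) :=
      Complex.I_pow_eq_pow_mod _
    rw [hmod4] at hwt
    have hodd' : (a z + (a (z - 1) + 2) % 4) % 2 = 1 := by omega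
    have hle := tp_adjacent_dist (ha4 z) (Nat.mod_lt _ (by norm_num)) hodd' (γ (c z)) (f t₀)
      ‖γ t - γ (c z)‖
    rw [← hwt, ← hzt₀] at hle
    have hft₀ : |f t₀| = f t₀ := abs_of_nonneg (norm_nonneg _)
    rw [hft₀] at hle
    change lam ≤ f t₀ at hlam1
    linarith
  · -- the same edge
    subst heq
    have htI : t ∈ Icc (c z') (c (z' + 1)) := ⟨ht.1, ht.2.le⟩
    have hwt : γ t = γ (c z') + ((f t : ℝ) : ℂ) * Complex.I ^ (a z') := hdir z' t htI
    refine ⟨f t - f t₀, ?_, ?_⟩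
    · have e : γ t - γ t₀ = ((f t - f t₀ : ℝ) : ℂ) * Complex.I ^ (a z') := by
        rw [hwt, hzt₀]; push_cast; ring
      have hn : dist (γ t) (γ t₀) = |f t - f t₀| := by
        rw [dist_eq_norm, e, norm_mul, norm_pow, Complex.norm_I, one_pow, mul_one,
          Complex.norm_real, Real.norm_eq_abs]
      rw [← hn]; exact hd
    · rw [hwt, hzt₀]; push_cast; ring
  · rcases eq_or_lt_of_le (show z + 1 ≤ z' by omega) with heq1 | hgt2
    · -- the next edge: too far (Pythagoras at the corner `γ (c (z+1))`)
      exfalso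
      subst heq1
      have htI : t ∈ Icc (c (z + 1)) (c (z + 1 + 1)) := ⟨ht.1, ht.2.le⟩
      have hwt := hdir (z + 1) t htI
      -- `γ t₀` seen from the end of the edge `z`
      obtain ⟨-, -, hin, -⟩ :=
        tp_seg_rebase_pow (hdir z) (hmono z) (s := c (z + 1))
          ⟨(hcmono (by omega : z < z + 1)).le, le_rfl⟩
      have hzt₀' := hin t₀ ht₀
      have hodd : (a (z + 1) + (a z + 2)) % 2 = 1 := by
        have := tp_consecutive_odd hτ hmodτ (z + 1); rw [add_sub_cancel_right] at this; omega
      have hmod4 : Complex.I ^ (a z + 2) = Complex.I ^ ((a z + 2) % 4) :=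
        Complex.I_pow_eq_pow_mod _
      rw [hmod4] at hzt₀'
      have hodd' : ((a z + 2) % 4 + a (z + 1)) % 2 = 1 := by omega
      have hle := tp_adjacent_dist (Nat.mod_lt _ (by norm_num)) (ha4 (z + 1)) hodd'
        (γ (c (z + 1))) ‖γ t₀ - γ (c (z + 1))‖ ‖γ t - γ (c (z + 1))‖
      rw [← hwt, ← hzt₀'] at hle
      rw [abs_of_nonneg (norm_nonneg _)] at hle
      rw [norm_sub_rev] at hlam2
      linarith
    · -- a non-adjacent edge: too far (`κ₀`)
      exfalso
      have htI : t ∈ Icc (c z') (c (z' + 1)) := ⟨ht.1, ht.2.le⟩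
      have hle := hκ₀ z z' (by omega) (by omega) t₀ ht₀ t htI
      rw [dist_comm] at hle
      linarith

/-- **The flat charts of radius `λ` along an edge.** If `q` is a frontier point of the Jordan
domain `D`, every frontier point within `λ` of `q` lies on the line `q + ℝ i^e`, and `q` has an
oriented pointwise flat chart in the frame `e` (the domain is locally the side `im u > 0`,
`u = (w - q)(-i)^e`), then within `λ` of `q`: `w ∈ closure D ↔ 0 ≤ im u` and
`w ∈ D ↔ 0 < im u` (half-disc dichotomy at radius `λ`, the side being fixed by the pointwise
chart). [folklore] -/
theorem tp_edge_chart (D : JordanDomain) {q : ℂ} {e : ℕ} {lam r₀ : ℝ}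
    (hq : q ∈ frontier D.carrier) (hlam : 0 < lam) (hr₀ : 0 < r₀)
    (hfr : ∀ w ∈ frontier D.carrier, dist w q < lam →
      ∃ s : ℝ, |s| < lam ∧ w = q + (s : ℂ) * Complex.I ^ e)
    (hdom : ∀ w, dist w q < r₀ → (w ∈ D.carrier ↔
      (2 = 1 → 0 < ((w - q) * (-Complex.I) ^ e).re ∧ 0 < ((w - q) * (-Complex.I) ^ e).im) ∧
        (2 = 2 → 0 < ((w - q) * (-Complex.I) ^ e).im) ∧
        (2 = 3 → 0 < ((w - q) * (-Complex.I) ^ e).im ∨ ((w - q) * (-Complex.I) ^ e).re < 0))) :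
    (∀ w, dist w q < lam → (w ∈ closure D.carrier ↔ 0 ≤ ((w - q) * (-Complex.I) ^ e).im)) ∧
      (∀ w, dist w q < lam → (w ∈ D.carrier ↔ 0 < ((w - q) * (-Complex.I) ^ e).im)) := by
  set ℓ : ℂ →L[ℝ] ℝ := Complex.imCLM.comp (ContinuousLinearMap.mul ℝ ℂ ((-Complex.I) ^ e))
    with hℓdef
  have hℓ : ∀ w, ℓ w = (w * (-Complex.I) ^ e).im := fun w => by
    simp only [hℓdef, ContinuousLinearMap.coe_comp, Function.comp_apply,
      ContinuousLinearMap.mul_apply', Complex.imCLM_apply, mul_comm]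
  have hu : 0 < ℓ (Complex.I ^ (e + 1)) := by
    rw [hℓ, pow_succ, mul_comm (Complex.I ^ e) Complex.I, mul_assoc, I_pow_mul_neg_I_pow,
      mul_one, Complex.I_im]
    exact one_pos
  have hflat : ∀ w ∈ frontier D.carrier, dist w q < lam → ℓ w = ℓ q := by
    intro w hw hwq
    obtain ⟨s, -, rfl⟩ := hfr w hw hwq
    rw [map_add, hℓ ((s : ℂ) * Complex.I ^ e), mul_assoc, I_pow_mul_neg_I_pow, mul_one,
      Complex.ofReal_im, add_zero]
  have hsub : ∀ w, ℓ w - ℓ q = ((w - q) * (-Complex.I) ^ e).im := fun w => by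
    rw [← map_sub, hℓ]
  rcases flat_halfDisc D ℓ (Complex.I ^ (e + 1)) hu hq hlam hflat with ⟨hcl, hD⟩ | ⟨-, hD⟩
  · refine ⟨fun w hw => ?_, fun w hw => ?_⟩
    · rw [hcl w hw, ← sub_nonneg, hsub]
    · rw [hD w hw, ← sub_pos, hsub]
  · exfalso
    have hm : 0 < min lam r₀ := lt_min hlam hr₀
    set ε := min lam r₀ / 2 with hε
    have hε0 : 0 < ε := by rw [hε]; linarith
    have hεl : ε < lam := by rw [hε]; linarith [min_le_left lam r₀]
    have hεr : ε < r₀ := by rw [hε]; linarith [min_le_right lam r₀]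
    set w₁ := q + (ε : ℂ) * Complex.I ^ (e + 1) with hw₁
    have hdist : dist w₁ q = ε := by
      rw [hw₁, dist_eq_norm, add_sub_cancel_left, norm_mul, norm_pow, Complex.norm_I, one_pow,
        mul_one, Complex.norm_real, Real.norm_eq_abs, abs_of_pos hε0]
    have him : ((w₁ - q) * (-Complex.I) ^ e).im = ε := by
      rw [hw₁, add_sub_cancel_left, pow_succ, mul_comm (Complex.I ^ e) Complex.I, ← mul_assoc,
        mul_assoc _ (Complex.I ^ e), I_pow_mul_neg_I_pow, mul_one, Complex.mul_im,
        Complex.ofReal_re, Complex.ofReal_im, Complex.I_re, Complex.I_im]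
      ring
    have hin : w₁ ∈ D.carrier :=
      (hdom w₁ (by rw [hdist]; exact hεr)).2 ⟨fun h => absurd h (by norm_num),
        fun _ => by rw [him]; exact hε0, fun h => absurd h (by norm_num)⟩
    have hout := (hD w₁ (by rw [hdist]; exact hεl)).1 hin
    have : ℓ w₁ - ℓ q = ε := by rw [hsub, him]
    linarith

/-- **Registered sub-goal `s7_edgeChart` of stub `stub_transportPaths`** (the flat charts of
radius `λ` along an edge, one-line form of `tp_edge_chart`). [folklore] -/
theorem s7_edgeChart : ∀ (D : Literature.Probability.RandomPlanarGeometry.JordanDomain) (q : ℂ) (e : ℕ) (lam r₀ : ℝ), q ∈ frontier D.carrier → 0 < lam → 0 < r₀ → (∀ w ∈ frontier D.carrier, dist w q < lam → ∃ s : ℝ, |s| < lam ∧ w = q + (s : ℂ) * Complex.I ^ e) → (∀ w, dist w q < r₀ → (w ∈ D.carrier ↔ (2 = 1 → 0 < ((w - q) * (-Complex.I) ^ e).re ∧ 0 < ((w - q) * (-Complex.I) ^ e).im) ∧ (2 = 2 → 0 < ((w - q) * (-Complex.I) ^ e).im) ∧ (2 = 3 → 0 < ((w - q) * (-Complex.I)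 ^ e).im ∨ ((w - q) * (-Complex.I) ^ e).re < 0))) → (∀ w, dist w q < lam → (w ∈ closure D.carrier ↔ 0 ≤ ((w - q) * (-Complex.I) ^ e).im)) ∧ (∀ w, dist w q < lam → (w ∈ D.carrier ↔ 0 < ((w - q) * (-Complex.I) ^ e).im)) :=
  fun D _ _ _ _ hq hlam hr₀ hfr hdom => tp_edge_chart D hq hlam hr₀ hfr hdom

end Summit.CriticalPhenomena.CardyFormulaZ2.Cruxes.BoundaryDefectGaussianR.RainbowMonomialsInExcursionKernels

end
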